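import Summits.ValiantsHypothesis.ValiantsHypothesis.Theorems.KPlusLogSqLawWeakLiftingTowerGraftTwoSidedTwoGaps
import Summits.ValiantsHypothesis.ValiantsHypothesis.Theorems.KPlusLogSqLawWeakLiftingTowerGraftTwoSidedThreeLettersLaw

/-!
# Tower graft line — THE TWO-SIDED THREE-LETTER `2m` LAW ON EVERY SUPPORT `a < b < c` (simple crossings)

Crux `stmt-ValiantsHypothesis-19561` (`WeakLifting`), line (B) `tower_graft`, two-sided word instrument; seat val-sym-lift-p3 g21,
`--supports 19561`, NO stub claimed.  Parts B/E (g20) proved `Z₊ ≤ 2m` for `X^d A + X^{d+e} J + X^{d+ne} B`, `n = 3, 5` (`A ≻ 0`,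
`B ≻ 0`, `J` ANY symmetric, every positive root a simple crossing).  With the two-gap certificate theorem (`…TwoSidedTwoGaps`) and the
Loewner certificate for every real exponent (`…TwoSidedLoewner`) the law holds on EVERY three-letter support:
`F(X) = X^{d₀} A + X^{d₀+e} J + X^{d₀+e+f} B`, `e, f ≥ 1` (`card_posRoots_le_two_mul_two_gaps`; literal `a < b < c` form
`card_posRoots_le_two_mul_of_lt`).  Mechanism: `Inertia.global_index_formula` gives `Z₊ = N⁻ + N⁺` with `N⁻ = N⁺` (`ν(A) = ν(B) = 0`), and
ONE of the two Loewner rank bounds always applies — `N⁺ ≤ rank B` when the lower gap is at most the upper gap (`e ≤ f`,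
`card_posType_roots_le_two_gaps`), `N⁻ ≤ rank A` when `f ≤ e` (`card_negType_roots_le_two_gaps`).  Type dictionary on every support:
`t·P_u′(t) = t^{d₀}(f t^{e+f}⟨u,Bu⟩ − e⟨u,Au⟩)` (`rayleigh_deriv_eq_two_gaps`).  Descartes' bound for the same determinant is quadratic in
`m` (`C(m+2,2) − 1` sign changes available); the law is linear.  Definite type of any corank: sequel `…AllSupportsDefinite`.
HONEST FRAMING: a structural law for three letters; the hypotheses `hcorank`/`htype` (simple crossings) travel with the statement;
nothing on the four-letter tower column, S4…S5, `TowerB`, `WeakLifting` in its window, Conjecture B, 18050 or `VP ≠ VNP`.  Def-free.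

[folklore] Loewner certificates + the inertia kit's global index formula.
-/

set_option linter.dupNamespace false
set_option autoImplicit false

namespace Summit.ValiantsHypothesis.ValiantsHypothesis.Theorems.KPlusLogSqLaw.TowerGraft

open Matrix
open scoped BigOperators

namespace TwoSidedThree

/-! ## §2 Census currency on EVERY three-letter support `(d₀, d₀+e, d₀+e+f)`, `e, f ≥ 1` -/

section Census

open Polynomial
open Summit.ValiantsHypothesis.ValiantsHypothesis.Theorems.LacunarySymmetroidMatrixDescartes

variable {m : ℕ}

/-- the three-letter pencil on `(d₀, d₀+e, d₀+e+f)` evaluated at `t` is `t^{d₀} · (A + t^e J + t^{e+f} B)`. [folklore] -/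
theorem pencil3_eval_two_gaps (A J B : Matrix (Fin m) (Fin m) ℝ) (d₀ e f : ℕ) (t : ℝ) :
    (∑ k : Fin 3, t ^ (![d₀, d₀ + e, d₀ + e + f] k) • (![A, J, B] k))
      = t ^ d₀ • (A + t ^ e • J + t ^ (e + f) • B) := by
  rw [Fin.sum_univ_three]
  simp only [Matrix.cons_val_zero, Matrix.cons_val_one, Matrix.cons_val]
  rw [smul_add, smul_add, smul_smul, smul_smul, ← pow_add, ← pow_add, Nat.add_assoc]

/-- kernel vectors of the evaluated pencil are kernel vectors of `A + t^e J + t^{e+f} B` (`t > 0`). [folklore] -/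
theorem reduced_kernel_two_gaps (A J B : Matrix (Fin m) (Fin m) ℝ) (d₀ e f : ℕ) {t : ℝ} (ht : 0 < t) (u : Fin m → ℝ)
    (hu : (∑ k : Fin 3, t ^ (![d₀, d₀ + e, d₀ + e + f] k) • (![A, J, B] k)) *ᵥ u = 0) :
    (A + t ^ e • J + t ^ (e + f) • B) *ᵥ u = 0 := by
  rw [pencil3_eval_two_gaps, Matrix.smul_mulVec] at hu
  exact (smul_eq_zero.mp hu).resolve_left (pow_ne_zero _ (ne_of_gt ht))

/-- **type dictionary on every support**: `t·P_u′(t) = t^{d₀}·(f·t^{e+f}⟨u,Bu⟩ − e·⟨u,Au⟩)` at a kernel vector `u`. [folklore] -/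
theorem rayleigh_deriv_eq_two_gaps (A J B : Matrix (Fin m) (Fin m) ℝ) (d₀ e f : ℕ) {t : ℝ} (ht : 0 < t) (u : Fin m → ℝ)
    (hu : (∑ k : Fin 3, t ^ (![d₀, d₀ + e, d₀ + e + f] k) • (![A, J, B] k)) *ᵥ u = 0) :
    t * (derivative (∑ k : Fin 3, C (u ⬝ᵥ ((![A, J, B] k) *ᵥ u)) * (X : ℝ[X]) ^ (![d₀, d₀ + e, d₀ + e + f] k))).eval t
      = t ^ d₀ * ((f : ℝ) * t ^ (e + f) * (u ⬝ᵥ (B *ᵥ u)) - e * (u ⬝ᵥ (A *ᵥ u))) := by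
  have hred := reduced_kernel_two_gaps A J B d₀ e f ht u hu
  -- the Rayleigh trinomial vanishes at `t`
  have hray : u ⬝ᵥ (A *ᵥ u) + t ^ e * (u ⬝ᵥ (J *ᵥ u)) + t ^ (e + f) * (u ⬝ᵥ (B *ᵥ u)) = 0 := by
    have h := congrArg (fun w => u ⬝ᵥ w) hred
    simp only [dotProduct_zero, Matrix.add_mulVec, Matrix.smul_mulVec, dotProduct_add, dotProduct_smul,
      smul_eq_mul] at h
    linarith
  rw [← Multiplicity.form_derivative_eq_eval]
  rw [Fin.sum_univ_three]
  simp only [Matrix.cons_val_zero, Matrix.cons_val_one, Matrix.cons_val, Matrix.add_mulVec, Matrix.smul_mulVec,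
    dotProduct_add, dotProduct_smul, smul_eq_mul]
  have h0 := SecularRolle.mul_natCast_mul_pow_pred t d₀
  have h1 := SecularRolle.mul_natCast_mul_pow_pred t (d₀ + e)
  have h2 := SecularRolle.mul_natCast_mul_pow_pred t (d₀ + e + f)
  rw [show t * (↑d₀ * t ^ (d₀ - 1) * (u ⬝ᵥ (A *ᵥ u)) + ↑(d₀ + e) * t ^ (d₀ + e - 1) * (u ⬝ᵥ (J *ᵥ u))
        + ↑(d₀ + e + f) * t ^ (d₀ + e + f - 1) * (u ⬝ᵥ (B *ᵥ u)))
      = (t * (↑d₀ * t ^ (d₀ - 1))) * (u ⬝ᵥ (A *ᵥ u)) + (t * (↑(d₀ + e) * t ^ (d₀ + e - 1))) * (u ⬝ᵥ (J *ᵥ u))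
        + (t * (↑(d₀ + e + f) * t ^ (d₀ + e + f - 1))) * (u ⬝ᵥ (B *ᵥ u)) by ring, h0, h1, h2]
  push_cast
  have hpe : t ^ (d₀ + e) = t ^ d₀ * t ^ e := pow_add _ _ _
  have hpf : t ^ (d₀ + e + f) = t ^ d₀ * t ^ (e + f) := by rw [Nat.add_assoc, pow_add]
  -- use the root relation to eliminate the `J` term
  have hJ : t ^ e * (u ⬝ᵥ (J *ᵥ u)) = -(u ⬝ᵥ (A *ᵥ u)) - t ^ (e + f) * (u ⬝ᵥ (B *ᵥ u)) := by linarith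
  rw [hpe, hpf]
  have h3 : (↑(d₀) + ↑e : ℝ) * (t ^ d₀ * t ^ e) * (u ⬝ᵥ (J *ᵥ u))
      = (↑d₀ + ↑e) * t ^ d₀ * (t ^ e * (u ⬝ᵥ (J *ᵥ u))) := by ring
  rw [h3, hJ]
  ring

/-- **positive-type roots on `(d₀, d₀+e, d₀+e+f)` with `e ≤ f` number at most `rank B`** (census currency; `A, B ⪰ 0`, `J` symmetric,
Loewner certificate of exponent `e/f`). [folklore] -/
theorem card_posType_roots_le_two_gaps (A J B : Matrix (Fin m) (Fin m) ℝ) (hA : A.PosSemidef) (hJ : J.IsSymm)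
    (hB : B.PosSemidef) (d₀ e f : ℕ) (he : 0 < e) (hef : e ≤ f) (T : Finset ℝ) (hT : ∀ t ∈ T, 0 < t)
    (hroot : ∀ t ∈ T, ∃ u : Fin m → ℝ, (∑ k : Fin 3, t ^ (![d₀, d₀ + e, d₀ + e + f] k) • (![A, J, B] k)) *ᵥ u = 0 ∧
      0 < (derivative (∑ k : Fin 3, C (u ⬝ᵥ ((![A, J, B] k) *ᵥ u)) * (X : ℝ[X]) ^ (![d₀, d₀ + e, d₀ + e + f] k))).eval t) :
    T.card ≤ B.rank := by
  classical
  choose! u hu using hroot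
  have h := card_posType_le_rank_two_gaps (I := T) A J B e f (fun t => (t : ℝ)) (fun t => u t) hA hJ hB
    (fun t => hT t t.2) Subtype.coe_injective he hef
    (fun t => reduced_kernel_two_gaps A J B d₀ e f (hT t t.2) _ (hu t t.2).1) ?_
  · simpa using h
  · intro t
    have ht := hT t t.2
    have hpos := (hu t t.2).2
    have heq := rayleigh_deriv_eq_two_gaps A J B d₀ e f ht _ (hu t t.2).1
    have h1 : 0 < t * (derivative (∑ k : Fin 3, C (u t ⬝ᵥ ((![A, J, B] k) *ᵥ u t)) *
        (X : ℝ[X]) ^ (![d₀, d₀ + e, d₀ + e + f] k))).eval (t : ℝ) := mul_pos ht hpos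
    rw [heq] at h1
    have h2 : 0 < (t : ℝ) ^ d₀ := pow_pos ht _
    have h3 : 0 < (f : ℝ) * (t : ℝ) ^ (e + f) * (u t ⬝ᵥ (B *ᵥ u t)) - e * (u t ⬝ᵥ (A *ᵥ u t)) := by
      by_contra hcon
      push Not at hcon
      have := mul_nonpos_of_nonneg_of_nonpos h2.le hcon
      linarith
    linarith

/-- **negative-type roots on `(d₀, d₀+e, d₀+e+f)` with `f ≤ e` number at most `rank A`** (census currency; mirror certificate).
[folklore] -/
theorem card_negType_roots_le_two_gaps (A J B : Matrix (Fin m) (Fin m) ℝ) (hA : A.PosSemidef) (hJ : J.IsSymm)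
    (hB : B.PosSemidef) (d₀ e f : ℕ) (hf : 0 < f) (hfe : f ≤ e) (T : Finset ℝ) (hT : ∀ t ∈ T, 0 < t)
    (hroot : ∀ t ∈ T, ∃ u : Fin m → ℝ, (∑ k : Fin 3, t ^ (![d₀, d₀ + e, d₀ + e + f] k) • (![A, J, B] k)) *ᵥ u = 0 ∧
      (derivative (∑ k : Fin 3, C (u ⬝ᵥ ((![A, J, B] k) *ᵥ u)) * (X : ℝ[X]) ^ (![d₀, d₀ + e, d₀ + e + f] k))).eval t < 0) :
    T.card ≤ A.rank := by
  classical
  choose! u hu using hroot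
  have h := card_negType_le_rank_two_gaps (I := T) A J B e f (fun t => (t : ℝ)) (fun t => u t) hA hJ hB
    (fun t => hT t t.2) Subtype.coe_injective hf hfe
    (fun t => reduced_kernel_two_gaps A J B d₀ e f (hT t t.2) _ (hu t t.2).1) ?_
  · simpa using h
  · intro t
    have ht := hT t t.2
    have hneg := (hu t t.2).2
    have heq := rayleigh_deriv_eq_two_gaps A J B d₀ e f ht _ (hu t t.2).1
    have h1 : t * (derivative (∑ k : Fin 3, C (u t ⬝ᵥ ((![A, J, B] k) *ᵥ u t)) *
        (X : ℝ[X]) ^ (![d₀, d₀ + e, d₀ + e + f] k))).eval (t : ℝ) < 0 := mul_neg_of_pos_of_neg ht hneg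
    rw [heq] at h1
    have h2 : 0 < (t : ℝ) ^ d₀ := pow_pos ht _
    have h3 : (f : ℝ) * (t : ℝ) ^ (e + f) * (u t ⬝ᵥ (B *ᵥ u t)) - e * (u t ⬝ᵥ (A *ᵥ u t)) < 0 := by
      by_contra hcon
      push Not at hcon
      have := mul_nonneg h2.le hcon
      linarith
    linarith

/-- **THE `2m` LAW FOR SIMPLE CROSSINGS ON EVERY THREE-LETTER SUPPORT** `(d₀, d₀+e, d₀+e+f)`, `e, f ≥ 1` (i.e. every
`a < b < c`).  `A ≻ 0`, `B ≻ 0`, `J` ANY symmetric, `F(X) = X^{d₀} A + X^{d₀+e} J + X^{d₀+e+f} B`, every positive root of `det F`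
a SIMPLE CROSSING (one-dimensional kernel of definite type).  Then the positive roots of `det F` counted with multiplicity number at
most `2m`: by `Inertia.global_index_formula` (`ν(A) = ν(B) = 0`) `Z₊ = N⁻ + N⁺` with `N⁻ = N⁺`, and ONE of the two Loewner rank
certificates always applies — `N⁺ ≤ rank B` if `e ≤ f`, `N⁻ ≤ rank A` if `f ≤ e`.  Parts B/E (`(d,d+e,d+3e)`, `(d,d+e,d+5e)`) are
the cases `f = 2e, 4e`. [folklore] -/
theorem card_posRoots_le_two_mul_two_gaps (A J B : Matrix (Fin m) (Fin m) ℝ) (hA : A.PosDef) (hJ : J.IsSymm) (hB : B.PosDef)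
    (d₀ e f : ℕ) (he : 0 < e) (hf : 0 < f)
    (hcorank : ∀ t : ℝ, 0 < t → (∑ k : Fin 3, t ^ (![d₀, d₀ + e, d₀ + e + f] k) • (![A, J, B] k)).det = 0 →
      (∑ k : Fin 3, t ^ (![d₀, d₀ + e, d₀ + e + f] k) • (![A, J, B] k)).rank + 1 = m)
    (htype : ∀ t : ℝ, 0 < t → (∑ k : Fin 3, t ^ (![d₀, d₀ + e, d₀ + e + f] k) • (![A, J, B] k)).det = 0 →
      (∀ u : Fin m → ℝ, (∑ k : Fin 3, t ^ (![d₀, d₀ + e, d₀ + e + f] k) • (![A, J, B] k)) *ᵥ u = 0 → u ≠ 0 →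
        (derivative (∑ k : Fin 3, C (u ⬝ᵥ ((![A, J, B] k) *ᵥ u)) * (X : ℝ[X]) ^ (![d₀, d₀ + e, d₀ + e + f] k))).eval t < 0) ∨
      (∀ u : Fin m → ℝ, (∑ k : Fin 3, t ^ (![d₀, d₀ + e, d₀ + e + f] k) • (![A, J, B] k)) *ᵥ u = 0 → u ≠ 0 →
        0 < (derivative (∑ k : Fin 3, C (u ⬝ᵥ ((![A, J, B] k) *ᵥ u)) * (X : ℝ[X]) ^ (![d₀, d₀ + e, d₀ + e + f] k))).eval t)) :
    Multiset.card ((Matrix.det (∑ k : Fin 3, ((X : ℝ[X]) ^ (![d₀, d₀ + e, d₀ + e + f] k)) • (![A, J, B] k).map C)).roots.filter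
        (fun t => 0 < t)) ≤ 2 * m := by
  classical
  set dv : Fin 3 → ℕ := ![d₀, d₀ + e, d₀ + e + f] with hdv
  set Sv : Fin 3 → Matrix (Fin m) (Fin m) ℝ := ![A, J, B] with hSv
  have hAs : A.IsSymm := by
    have h1 := hA.1; unfold Matrix.IsHermitian at h1
    rwa [Matrix.conjTranspose_eq_transpose_of_trivial] at h1
  have hBs : B.IsSymm := by
    have h1 := hB.1; unfold Matrix.IsHermitian at h1
    rwa [Matrix.conjTranspose_eq_transpose_of_trivial] at h1
  have hS : ∀ k, (Sv k).IsSymm := by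
    intro k; fin_cases k
    · exact hAs
    · exact hJ
    · exact hBs
  have hmin : ∀ l : Fin 3, l ≠ 0 → dv 0 < dv l := by
    intro l hl; fin_cases l
    · exact absurd rfl hl
    · show d₀ < d₀ + e; omega
    · show d₀ < d₀ + e + f; omega
  have hmax : ∀ l : Fin 3, l ≠ 2 → dv l < dv 2 := by
    intro l hl; fin_cases l
    · show d₀ < d₀ + e + f; omega
    · show d₀ + e < d₀ + e + f; omega
    · exact absurd rfl hl
  have h0 : (Sv 0).det ≠ 0 := by show A.det ≠ 0; exact hA.det_pos.ne'
  have h2 : (Sv 2).det ≠ 0 := by show B.det ≠ 0; exact hB.det_pos.ne'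
  -- the negative-type predicate
  let negType : ℝ → Prop := fun t => ∀ u : Fin m → ℝ, (∑ k, t ^ dv k • Sv k) *ᵥ u = 0 → u ≠ 0 →
    (derivative (∑ k, C (u ⬝ᵥ (Sv k *ᵥ u)) * (X : ℝ[X]) ^ dv k)).eval t < 0
  obtain ⟨hidx, -, hsum⟩ := Inertia.global_index_formula dv Sv hS 0 2 hmin hmax h0 h2 htype negType
    (fun t _ _ => Iff.rfl)
  -- `ν(A) = ν(B) = 0`
  have hνA : Fintype.card {j // (Inertia.isHermitian_of_isSymm (hS 0)).eigenvalues j < 0} = 0 := by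
    rw [Fintype.card_eq_zero_iff]
    refine ⟨fun ⟨j, hj⟩ => ?_⟩
    have hp : 0 < (Inertia.isHermitian_of_isSymm (hS 0)).eigenvalues j := hA.eigenvalues_pos j
    linarith
  have hνB : Fintype.card {j // (Inertia.isHermitian_of_isSymm (hS 2)).eigenvalues j < 0} = 0 := by
    rw [Fintype.card_eq_zero_iff]
    refine ⟨fun ⟨j, hj⟩ => ?_⟩
    have hp : 0 < (Inertia.isHermitian_of_isSymm (hS 2)).eigenvalues j := hB.eigenvalues_pos j
    linarith
  rw [hνA, hνB, zero_add, zero_add] at hidx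
  -- abbreviations
  set P := Matrix.det (∑ k, ((X : ℝ[X]) ^ dv k) • (Sv k).map C) with hP
  have hdef : ∀ t : ℝ, 0 < t → (∑ k, t ^ dv k • Sv k).det = 0 → ∀ v : Fin m → ℝ, (∑ k, t ^ dv k • Sv k) *ᵥ v = 0 →
      v ≠ 0 → (derivative (∑ k, C (v ⬝ᵥ (Sv k *ᵥ v)) * (X : ℝ[X]) ^ dv k)).eval t ≠ 0 := by
    intro t ht hdet v hv hv0
    rcases htype t ht hdet with h | h
    · exact ne_of_lt (h v hv hv0)
    · exact ne_of_gt (h v hv hv0)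
  -- every positive root is simple, so any sub-multiset of the positive roots has no repetition
  have hnodup : ∀ (q : ℝ → Prop) [DecidablePred q], (∀ t, q t → 0 < t) → (P.roots.filter q).Nodup := by
    intro q _ hq
    rw [Multiset.nodup_iff_count_le_one]
    intro a
    by_cases hqa : q a
    · rw [Multiset.count_filter_of_pos hqa, count_roots]
      by_cases hr : (∑ k, a ^ dv k • Sv k).det = 0
      · have h1 := Multiplicity.rootMultiplicity_det_pencil_eq_one dv Sv hS a
          (by rw [Fintype.card_fin]; exact hcorank a (hq a hqa) hr) (hdef a (hq a hqa) hr)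
        rw [← hP] at h1
        omega
      · have hnr : ¬ P.IsRoot a := by
          intro hroot
          apply hr
          have h1 : P.eval a = 0 := hroot
          rwa [hP, DefiniteMoments.eval_det_pencil] at h1
        rw [Polynomial.rootMultiplicity_eq_zero hnr]
        exact zero_le_one
    · rw [Multiset.count_filter_of_neg hqa]
      exact zero_le_one
  -- kernel vectors at roots
  have hkerv : ∀ t : ℝ, t ∈ P.roots → ∃ u : Fin m → ℝ, u ≠ 0 ∧ (∑ k, t ^ dv k • Sv k) *ᵥ u = 0 ∧
      (∑ k, t ^ dv k • Sv k).det = 0 := by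
    intro t hmem
    obtain ⟨hP0, hroot⟩ := (Polynomial.mem_roots').mp hmem
    have hdet : (∑ k, t ^ dv k • Sv k).det = 0 := by
      have h1 : P.eval t = 0 := hroot
      rwa [hP, DefiniteMoments.eval_det_pencil] at h1
    obtain ⟨u, hu0, hu⟩ := Matrix.exists_mulVec_eq_zero_iff.mpr hdet
    exact ⟨u, hu0, hu, hdet⟩
  have hAm : A.rank ≤ m := (Matrix.rank_le_width A).trans le_rfl
  have hBm : B.rank ≤ m := (Matrix.rank_le_width B).trans le_rfl
  rw [← hsum]
  rcases le_total e f with hef | hfe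
  · -- `e ≤ f`: bound the POSITIVE-type roots by `rank B`
    set q : ℝ → Prop := fun t => 0 < t ∧ ¬ negType t with hq
    set T := (P.roots.filter q).toFinset with hTdef
    have hTcard : T.card = Multiset.card (P.roots.filter q) :=
      Multiset.toFinset_card_of_nodup (hnodup q fun t ht => ht.1)
    have hTpos : ∀ t ∈ T, 0 < t := fun t ht => (Multiset.mem_filter.mp (Multiset.mem_toFinset.mp ht)).2.1
    have hTroot : ∀ t ∈ T, ∃ u : Fin m → ℝ, (∑ k : Fin 3, t ^ (dv k) • (Sv k)) *ᵥ u = 0 ∧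
        0 < (derivative (∑ k : Fin 3, C (u ⬝ᵥ ((Sv k) *ᵥ u)) * (X : ℝ[X]) ^ (dv k))).eval t := by
      intro t ht
      obtain ⟨hmem, htq⟩ := Multiset.mem_filter.mp (Multiset.mem_toFinset.mp ht)
      obtain ⟨u, hu0, hu, hdet⟩ := hkerv t hmem
      refine ⟨u, hu, ?_⟩
      rcases htype t htq.1 hdet with hneg | hposT
      · exact absurd hneg htq.2
      · exact hposT u hu hu0
    have hTle : T.card ≤ B.rank :=
      card_posType_roots_le_two_gaps A J B hA.posSemidef hJ hB.posSemidef d₀ e f he hef T hTpos hTroot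
    have hN : Multiset.card (P.roots.filter q) ≤ m := by rw [← hTcard]; exact hTle.trans hBm
    have hidx' : Multiset.card (P.roots.filter fun t => 0 < t ∧ negType t) = Multiset.card (P.roots.filter q) :=
      hidx.symm
    rw [hidx']
    omega
  · -- `f ≤ e`: bound the NEGATIVE-type roots by `rank A`
    set q : ℝ → Prop := fun t => 0 < t ∧ negType t with hq
    set T := (P.roots.filter q).toFinset with hTdef
    have hTcard : T.card = Multiset.card (P.roots.filter q) :=
      Multiset.toFinset_card_of_nodup (hnodup q fun t ht => ht.1)
    have hTpos : ∀ t ∈ T, 0 < t := fun t ht => (Multiset.mem_filter.mp (Multiset.mem_toFinset.mp ht)).2.1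
    have hTroot : ∀ t ∈ T, ∃ u : Fin m → ℝ, (∑ k : Fin 3, t ^ (dv k) • (Sv k)) *ᵥ u = 0 ∧
        (derivative (∑ k : Fin 3, C (u ⬝ᵥ ((Sv k) *ᵥ u)) * (X : ℝ[X]) ^ (dv k))).eval t < 0 := by
      intro t ht
      obtain ⟨hmem, htq⟩ := Multiset.mem_filter.mp (Multiset.mem_toFinset.mp ht)
      obtain ⟨u, hu0, hu, hdet⟩ := hkerv t hmem
      exact ⟨u, hu, htq.2 u hu hu0⟩
    have hTle : T.card ≤ A.rank :=
      card_negType_roots_le_two_gaps A J B hA.posSemidef hJ hB.posSemidef d₀ e f hf hfe T hTpos hTroot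
    have hN : Multiset.card (P.roots.filter q) ≤ m := by rw [← hTcard]; exact hTle.trans hAm
    have hidx' : Multiset.card (P.roots.filter fun t => 0 < t ∧ ¬ negType t) = Multiset.card (P.roots.filter q) := hidx
    rw [hidx']
    omega

/-- **THE `2m` LAW ON EVERY SUPPORT `a < b < c`** — `card_posRoots_le_two_mul_two_gaps` with `d₀ = a`, `e = b − a`, `f = c − b`:
`F(X) = X^a A + X^b J + X^c B`, `A ≻ 0`, `B ≻ 0`, `J` any symmetric, every positive root a simple crossing ⇒ the positive roots of
`det F` with multiplicity number at most `2m`. [folklore] -/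
theorem card_posRoots_le_two_mul_of_lt (A J B : Matrix (Fin m) (Fin m) ℝ) (hA : A.PosDef) (hJ : J.IsSymm) (hB : B.PosDef)
    (a b c : ℕ) (hab : a < b) (hbc : b < c)
    (hcorank : ∀ t : ℝ, 0 < t → (∑ k : Fin 3, t ^ (![a, b, c] k) • (![A, J, B] k)).det = 0 →
      (∑ k : Fin 3, t ^ (![a, b, c] k) • (![A, J, B] k)).rank + 1 = m)
    (htype : ∀ t : ℝ, 0 < t → (∑ k : Fin 3, t ^ (![a, b, c] k) • (![A, J, B] k)).det = 0 →
      (∀ u : Fin m → ℝ, (∑ k : Fin 3, t ^ (![a, b, c] k) • (![A, J, B] k)) *ᵥ u = 0 → u ≠ 0 →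
        (derivative (∑ k : Fin 3, C (u ⬝ᵥ ((![A, J, B] k) *ᵥ u)) * (X : ℝ[X]) ^ (![a, b, c] k))).eval t < 0) ∨
      (∀ u : Fin m → ℝ, (∑ k : Fin 3, t ^ (![a, b, c] k) • (![A, J, B] k)) *ᵥ u = 0 → u ≠ 0 →
        0 < (derivative (∑ k : Fin 3, C (u ⬝ᵥ ((![A, J, B] k) *ᵥ u)) * (X : ℝ[X]) ^ (![a, b, c] k))).eval t)) :
    Multiset.card ((Matrix.det (∑ k : Fin 3, ((X : ℝ[X]) ^ (![a, b, c] k)) • (![A, J, B] k).map C)).roots.filter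
        (fun t => 0 < t)) ≤ 2 * m := by
  obtain ⟨e, rfl⟩ := Nat.exists_eq_add_of_lt hab
  obtain ⟨f, rfl⟩ := Nat.exists_eq_add_of_lt hbc
  have h := card_posRoots_le_two_mul_two_gaps A J B hA hJ hB a (e + 1) (f + 1) (Nat.succ_pos e) (Nat.succ_pos f)
  simp only [← Nat.add_assoc] at h
  exact h hcorank htype

end Census

end TwoSidedThree

end Summit.ValiantsHypothesis.ValiantsHypothesis.Theorems.KPlusLogSqLaw.TowerGraft
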